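import Summits.KontsevichZagierPeriods.KontsevichZagierPeriods.Theorems.SymplecticScissorsVolumeFormOffPlaneTriToBox

/-!
# Crux `VolumeFormOffPlane` (stmt-KontsevichZagierPeriods-14935) — line `Sketch`,
stub `stub_torsionClosure` (torsion closure of a weighted sector)

A class `G` of integral representations has the `ℤ`-WEIGHTED PROPERTY if every finite
`ℤ`-weighted family over `G` with total weighted value `0` has weighted formal sum in
`KZ.relations`. `stub_torsionClosure`: the property passes from `G` to every finite family of
representations `ρ i` whose members with non-zero weight carry a CERTIFICATE
`d • [ρ i] − Σⱼ wⱼ • [σⱼ] ∈ KZ.relations` (`d ≠ 0`, `σⱼ ∈ G` whenever `wⱼ ≠ 0`).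

Proof (bookkeeping): let `D = ∏ dᵢ` and `Eᵢ = ∏_{i' ≠ i} d_{i'}`, so `dᵢ Eᵢ = D`. Then
`D • Σ cᵢ • [ρ i] = Σᵢ Eᵢ • (cᵢ • (dᵢ • [ρ i] − Σⱼ wᵢⱼ • [σᵢⱼ])) + Σᵢ Σⱼ (Eᵢ cᵢ wᵢⱼ) • [σᵢⱼ]`;
the first sum is a relation by the certificates, the second by the property of `G` applied to
the flattened family (its weighted value is `D · Σ cᵢ value(ρ i) = 0` by soundness
`KZ.relations_le_ker_eval_holds` applied to each certificate). Conclude by torsion-freeness of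
`FormalRep ⧸ relations` (`MultiplicationAccessible.Negative.mem_relations_of_zsmul_mem_relations`).

Sources: M. Kontsevich, D. Zagier, *Periods* (2001), §1.2 (the calculus and its soundness);
the closure argument is folklore.
-/

noncomputable section

open MeasureTheory Set
open Literature.NumberTheory.Transcendental

namespace Summit.KontsevichZagierPeriods.SymplecticScissors.LogPolytope

/-! ## Reindexing -/

/-- The `ℤ`-weighted property of a class, stated for `Fin`-indexed families, holds for families
indexed by any finite type (reindex along `Fintype.equivFin`). [folklore] -/
theorem tcl_weighted_fintype {N : ℕ} {G : KZ.IntegralRep N → Prop}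
    (hG : ∀ (k : ℕ) (σ : Fin k → KZ.IntegralRep N) (w : Fin k → ℤ),
      (∀ j, w j ≠ 0 → G (σ j)) → ∑ j, (w j : ℝ) * (σ j).value = 0 →
      ∑ j, w j • KZ.of (σ j) ∈ KZ.relations)
    {ι : Type} [Fintype ι] (σ : ι → KZ.IntegralRep N) (w : ι → ℤ)
    (hw : ∀ j, w j ≠ 0 → G (σ j)) (hv : ∑ j, (w j : ℝ) * (σ j).value = 0) :
    ∑ j, w j • KZ.of (σ j) ∈ KZ.relations := by
  set e := Fintype.equivFin ι
  have h := hG (Fintype.card ι) (fun m => σ (e.symm m)) (fun m => w (e.symm m))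
    (fun m hm => hw _ hm) (by rw [e.symm.sum_comp (fun j => (w j : ℝ) * (σ j).value), hv])
  rwa [e.symm.sum_comp (fun j => w j • KZ.of (σ j))] at h

/-! ## The closure argument with chosen certificate data -/

/-- **Torsion closure, functional form.** Given the `ℤ`-weighted property of `G`, a family `ρ`
with weights `c`, and for EVERY index certificate data `d i ≠ 0`, `σ i`, `w i` over `G` with
`c i • (d i • [ρ i] − Σⱼ w i j • [σ i j]) ∈ KZ.relations`, total weighted value `0` forces
`Σ c i • [ρ i] ∈ KZ.relations`. [folklore] -/
theorem tcl_core {N k : ℕ} {G : KZ.IntegralRep N → Prop}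
    (hG : ∀ (k : ℕ) (σ : Fin k → KZ.IntegralRep N) (w : Fin k → ℤ),
      (∀ j, w j ≠ 0 → G (σ j)) → ∑ j, (w j : ℝ) * (σ j).value = 0 →
      ∑ j, w j • KZ.of (σ j) ∈ KZ.relations)
    (ρ : Fin k → KZ.IntegralRep N) (c : Fin k → ℤ) (d : Fin k → ℤ) (l : Fin k → ℕ)
    (σ : ∀ i, Fin (l i) → KZ.IntegralRep N) (w : ∀ i, Fin (l i) → ℤ)
    (hd : ∀ i, d i ≠ 0) (hGσ : ∀ i j, w i j ≠ 0 → G (σ i j))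
    (hcert : ∀ i, c i • (d i • KZ.of (ρ i) - ∑ j, w i j • KZ.of (σ i j)) ∈ KZ.relations)
    (hval : ∑ i, (c i : ℝ) * (ρ i).value = 0) :
    ∑ i, c i • KZ.of (ρ i) ∈ KZ.relations := by
  -- `D = ∏ dᵢ ≠ 0` and the complementary products `Eᵢ` with `dᵢ * Eᵢ = D`
  obtain ⟨D, hD0, E, hDE⟩ : ∃ D : ℤ, D ≠ 0 ∧ ∃ E : Fin k → ℤ, ∀ i, d i * E i = D :=
    ⟨∏ i, d i, Finset.prod_ne_zero_iff.mpr fun i _ => hd i,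
      fun i => ∏ i' ∈ Finset.univ.erase i, d i',
      fun i => Finset.mul_prod_erase _ _ (Finset.mem_univ i)⟩
  -- soundness of each certificate
  have hsound : ∀ i, (c i : ℝ) * ∑ j, (w i j : ℝ) * (σ i j).value =
      (c i : ℝ) * ((d i : ℝ) * (ρ i).value) := by
    intro i
    have h : KZ.eval (c i • (d i • KZ.of (ρ i) - ∑ j, w i j • KZ.of (σ i j))) = 0 :=
      AddMonoidHom.mem_ker.mp (KZ.relations_le_ker_eval_holds (hcert i))
    simp only [map_zsmul, map_sub, map_sum, KZ.eval_of, zsmul_eq_mul] at h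
    rw [mul_sub, sub_eq_zero] at h
    exact h.symm
  -- the property of `G` applied to the flattened family `(i, j) ↦ σ i j`, weights `Eᵢ cᵢ wᵢⱼ`
  have hflat : ∑ i, ∑ j, (E i * c i * w i j) • KZ.of (σ i j) ∈ KZ.relations := by
    have h := tcl_weighted_fintype hG (ι := Σ i, Fin (l i)) (fun p => σ p.1 p.2)
      (fun p => E p.1 * c p.1 * w p.1 p.2) (fun p hp => hGσ _ _ (right_ne_zero_of_mul hp)) (by
        simp only [Fintype.sum_sigma]
        push_cast
        simp_rw [mul_assoc, ← Finset.mul_sum, hsound]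
        have hE : ∀ i, (E i : ℝ) * ((c i : ℝ) * ((d i : ℝ) * (ρ i).value)) =
            (D : ℝ) * ((c i : ℝ) * (ρ i).value) := fun i => by
          rw [← hDE i]; push_cast; ring
        simp_rw [hE, ← Finset.mul_sum, hval, mul_zero])
    simpa only [Fintype.sum_sigma] using h
  -- `D • Σ cᵢ • [ρ i]` is a relation: substitute the certificates
  refine Summit.KontsevichZagierPeriods.MultiplicationAccessible.Negative.mem_relations_of_zsmul_mem_relations
    hD0 ?_
  have key : D • ∑ i, c i • KZ.of (ρ i) =
      ∑ i, E i • (c i • (d i • KZ.of (ρ i) - ∑ j, w i j • KZ.of (σ i j))) +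
        ∑ i, ∑ j, (E i * c i * w i j) • KZ.of (σ i j) := by
    rw [Finset.smul_sum, ← Finset.sum_add_distrib]
    refine Finset.sum_congr rfl fun i _ => ?_
    simp only [smul_sub, smul_smul, Finset.smul_sum, mul_assoc, sub_add_cancel]
    rw [← hDE i]
    congr 1
    ring
  rw [key]
  exact add_mem (sum_mem fun i _ => KZ.relations.zsmul_mem (hcert i) _) hflat

/-! ## The stub -/

/-- **Stub v6-6 (TORSION CLOSURE of a sector).** If a class `G` of representations has the
`ℤ`-weighted property "total weighted value `0` ⇒ the weighted formal sum is a relation", then so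
does the class of all representations `ρ` admitting a certificate `d • [ρ] ≡ Σ wⱼ • [σⱼ]`
(`d ≥ 1`, `σⱼ ∈ G`): multiply by `D = ∏ dᵢ`, substitute the certificates (their values agree by
soundness `relations_le_ker_eval_holds`), apply the property of `G` to the flattened family, and
divide by `D` (`FormalRep ⧸ relations` is torsion-free:
`MultiplicationAccessible.Negative.mem_relations_of_nsmul_mem_relations`). Indices with `c i = 0`
get the dummy certificate `1 • [ρ i] − 0`, harmless after multiplication by `c i`. [folklore] -/
theorem stub_torsionClosure : ∀ (N : ℕ) (G : KZ.IntegralRep N → Prop),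
    (∀ (k : ℕ) (σ : Fin k → KZ.IntegralRep N) (w : Fin k → ℤ),
      (∀ j, w j ≠ 0 → G (σ j)) → ∑ j, (w j : ℝ) * (σ j).value = 0 →
      ∑ j, w j • KZ.of (σ j) ∈ KZ.relations) →
    ∀ (k : ℕ) (ρ : Fin k → KZ.IntegralRep N) (c : Fin k → ℤ),
      (∀ i, c i ≠ 0 → ∃ (d l : ℕ) (σ : Fin l → KZ.IntegralRep N) (w : Fin l → ℤ), d ≠ 0 ∧
        (∀ j, w j ≠ 0 → G (σ j)) ∧ d • KZ.of (ρ i) - ∑ j, w j • KZ.of (σ j) ∈ KZ.relations) →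
      ∑ i, (c i : ℝ) * (ρ i).value = 0 →
      ∑ i, c i • KZ.of (ρ i) ∈ KZ.relations := by
  intro N G hG k ρ c hc hval
  -- uniformise the certificates: integer multiplier, dummy data where `c i = 0`
  have hc' : ∀ i, ∃ (d : ℤ) (l : ℕ) (σ : Fin l → KZ.IntegralRep N) (w : Fin l → ℤ), d ≠ 0 ∧
      (∀ j, w j ≠ 0 → G (σ j)) ∧
      c i • (d • KZ.of (ρ i) - ∑ j, w j • KZ.of (σ j)) ∈ KZ.relations := by
    intro i
    by_cases hci : c i = 0
    · refine ⟨1, 0, Fin.elim0, Fin.elim0, one_ne_zero, fun j => Fin.elim0 j, ?_⟩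
      rw [hci, zero_smul]
      exact zero_mem _
    · obtain ⟨d, l, σ, w, hd, hGσ, hrel⟩ := hc i hci
      refine ⟨d, l, σ, w, Int.natCast_ne_zero.mpr hd, hGσ, ?_⟩
      rw [natCast_zsmul]
      exact KZ.relations.zsmul_mem hrel _
  choose d l σ w hd hGσ hcert using hc'
  exact tcl_core hG ρ c d l σ w hd hGσ hcert hval

end Summit.KontsevichZagierPeriods.SymplecticScissors.LogPolytope

end
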